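import Mathlib
import HarnessLib
import Summits.ValiantsHypothesis.ValiantsHypothesis.Theorems.LacunarySymmetroidMatrixDescartesOsculationCensusRankTwoCert

/-!
# ValiantsHypothesis / LacunarySymmetroid — crux `MatrixDescartes` (stmt-ValiantsHypothesis-18050, V1),
# line «osculation-law», rung O3: DEGREE BOOKKEEPING for the rank-two reduction pair `U, V` and the eliminant `N`

Roster R2664 (b) / R2685 (O3 = val-sym-engine-7; this file engine-7 g4).  The `(2, s)` certificate ✓ `OsculationCensus.osc_rankTwo_finite_card_le`
(`…OsculationCensusRankTwoSCert`) bounds the osculation count by `2·(N_N + N_U)` for degree bounds `deg N ≤ N_N`, `deg U ≤ N_U`, where `U`, `V` are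
the tree's reduction polynomials of ✓ `OsculationCuspGen.hess_reduce_poly` (homogeneous of degree 7 in `a, m, δ`, isobaric of weights 12 / 13 for
`wt(a, m, δ) = (1, 2, 3)`, `θ = X·d/dX` weightless) and `N = a V² − m U V + δ U²` (degree 15, weight 27).  This file turns degree bounds in ARITHMETIC
PROGRESSION `deg a ≤ α`, `deg m ≤ α + n`, `deg δ ≤ α + 2n` (true for every `(2, s)` splitting of a pencil with top exponent `n`, `α = s·n`) into
`deg U ≤ 7α + 5n` (`natDegree_U_le`), `deg V ≤ 7α + 6n` (`natDegree_V_le`), `deg N ≤ 15α + 12n` (`natDegree_N_le`) — term by term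
(`natDegree_mul_le`, `natDegree_pow_le_of_le`, ✓ `natDegree_X_mul_derivative_le`, ✓ `natDegree_add_le_of_le'` / `natDegree_sub_le_of_le'`) and `omega`.

HONEST FRAMING.  Bookkeeping for an instance calibration of a line stub; LAW / MatrixDescartes / Conjecture B / `VP ≠ VNP` OPEN; no summit statement is
proved by this file.  No definitions, no named facts.
-/

-- `Summit.ValiantsHypothesis.ValiantsHypothesis.…` is the tree's mandated single-conjunct layout (Sub = Summit).
set_option linter.dupNamespace false

noncomputable section

namespace Summit.ValiantsHypothesis.ValiantsHypothesis.Theorems.LacunarySymmetroidMatrixDescartes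

open Polynomial

namespace OsculationCensus

/-- Numeral polynomials have degree `0`. [folklore] -/
theorem natDegree_ofNat_le' (k : ℕ) [k.AtLeastTwo] : (OfNat.ofNat k : ℝ[X]).natDegree ≤ 0 := by
  simp

/-- `deg (p q) ≤ i + j` from `deg p ≤ i`, `deg q ≤ j`. [folklore] -/
theorem natDegree_mul_le_of_le'' {p q : ℝ[X]} {i j : ℕ} (hp : p.natDegree ≤ i) (hq : q.natDegree ≤ j) :
    (p * q).natDegree ≤ i + j :=
  natDegree_mul_le.trans (Nat.add_le_add hp hq)

-- the statement carries `U` (20 products of polynomials).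
set_option maxHeartbeats 800000 in
/-- **`deg U ≤ 7α + 5n`** for the weight-12 reduction polynomial `U` of `OsculationCuspGen.hess_reduce_poly`, given `deg a ≤ α`, `deg m ≤ α + n`,
`deg δ ≤ α + 2n`. [folklore] -/
theorem natDegree_U_le (a m δ Up : ℝ[X]) (α n : ℕ) (ha : a.natDegree ≤ α) (hm : m.natDegree ≤ α + n) (hd : δ.natDegree ≤ α + 2 * n)
    (hUp : Up = (4 : ℝ[X]) * a ^ 4 * m * δ * (X * derivative (X * derivative δ)) - (3 : ℝ[X]) * a ^ 4 * m * (X * derivative δ) ^ 2 + (4 : ℝ[X]) * a ^ 4 * δ ^ 2 * (X * derivative (X * derivative m)) - (4 : ℝ[X]) * a ^ 4 * δ * (X * derivative m) * (X * derivative δ) - a ^ 3 * m ^ 3 * (X * derivative (X * derivative δ)) - (5 : ℝ[X]) * a ^ 3 * m ^ 2 * δ * (X * derivative (X * derivative m)) + (4 : ℝ[X]) * a ^ 3 * m ^ 2 * (X * derivative m) * (X * derivative δ) - (8 : ℝ[X]) * a ^ 3 * m * δ ^ 2 * (X * derivative (X * derivative a)) + (2 : ℝ[X]) * a ^ 3 *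 m * δ * (X * derivative a) * (X * derivative δ) + a ^ 3 * m * δ * (X * derivative m) ^ 2 - (4 : ℝ[X]) * a ^ 3 * δ ^ 2 * (X * derivative a) * (X * derivative m) + a ^ 2 * m ^ 4 * (X * derivative (X * derivative m)) + (6 : ℝ[X]) * a ^ 2 * m ^ 3 * δ * (X * derivative (X * derivative a)) - (2 : ℝ[X]) * a ^ 2 * m ^ 3 * (X * derivative a) * (X * derivative δ) - a ^ 2 * m ^ 3 * (X * derivative m) ^ 2 + (4 : ℝ[X]) * a ^ 2 * m ^ 2 * δ * (X * derivative a) * (X * derivative m) + (9 : ℝ[X]) * a ^ 2 * m * δ ^ 2 * (X * derivative a) ^ 2 - a * m ^ 5 * (X * derivative (X * derivative a)) - (7 : ℝ[X]) * a * m ^ 3 * δ * (X * derivative a) ^ 2 + m ^ 5 * (X * derivative a) ^ 2) : Up.natDegree ≤ 7 * α + 5 * n := by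
  rw [hUp]
  exact (natDegree_add_le_of_le' (natDegree_sub_le_of_le' (natDegree_sub_le_of_le' (natDegree_add_le_of_le' (natDegree_add_le_of_le' (natDegree_sub_le_of_le' (natDegree_sub_le_of_le' (natDegree_add_le_of_le' (natDegree_add_le_of_le' (natDegree_sub_le_of_le' (natDegree_add_le_of_le' (natDegree_add_le_of_le' (natDegree_sub_le_of_le' (natDegree_add_le_of_le' (natDegree_sub_le_of_le' (natDegree_sub_le_of_le' (natDegree_sub_le_of_le' (natDegree_add_le_of_le' (natDegree_sub_le_of_le' (((natDegree_mul_le_of_le'' (natDegree_mul_le_of_le'' (natDegree_mul_le_of_le'' (natDegree_mul_le_of_le'' (natDegree_ofNat_le' 4) (natDegree_pow_le_of_le 4 ha)) hm) hd) ((natDegree_X_mul_derivative_le _).trans ((natDegree_X_mul_derivative_le _).trans hd)))).trans (by omega)) (((natDegree_mul_le_of_le'' (natDegree_mul_le_of_le'' (natDegree_mul_le_of_le'' (natDegree_ofNat_le' 3) (natDegree_pow_le_of_le 4 ha)) hm) (natDegree_pow_le_of_le 2 ((natDegree_X_mul_derivative_le _).trans hd)))).trans (by omega))) (((natDegree_mul_le_of_le''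 (natDegree_mul_le_of_le'' (natDegree_mul_le_of_le'' (natDegree_ofNat_le' 4) (natDegree_pow_le_of_le 4 ha)) (natDegree_pow_le_of_le 2 hd)) ((natDegree_X_mul_derivative_le _).trans ((natDegree_X_mul_derivative_le _).trans hm)))).trans (by omega))) (((natDegree_mul_le_of_le'' (natDegree_mul_le_of_le'' (natDegree_mul_le_of_le'' (natDegree_mul_le_of_le'' (natDegree_ofNat_le' 4) (natDegree_pow_le_of_le 4 ha)) hd) ((natDegree_X_mul_derivative_le _).trans hm)) ((natDegree_X_mul_derivative_le _).trans hd))).trans (by omega))) (((natDegree_mul_le_of_le'' (natDegree_mul_le_of_le'' (natDegree_pow_le_of_le 3 ha) (natDegree_pow_le_of_le 3 hm)) ((natDegree_X_mul_derivative_le _).trans ((natDegree_X_mul_derivative_le _).trans hd)))).trans (by omega))) (((natDegree_mul_le_of_le'' (natDegree_mul_le_of_le'' (natDegree_mul_le_of_le'' (natDegree_mul_le_of_le'' (natDegree_ofNat_le' 5) (natDegree_pow_le_of_le 3 ha)) (natDegree_pow_le_of_le 2 hm)) hd) ((natDegree_X_mul_derivative_le _).trans ((natDegree_X_mul_derivative_le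 _).trans hm)))).trans (by omega))) (((natDegree_mul_le_of_le'' (natDegree_mul_le_of_le'' (natDegree_mul_le_of_le'' (natDegree_mul_le_of_le'' (natDegree_ofNat_le' 4) (natDegree_pow_le_of_le 3 ha)) (natDegree_pow_le_of_le 2 hm)) ((natDegree_X_mul_derivative_le _).trans hm)) ((natDegree_X_mul_derivative_le _).trans hd))).trans (by omega))) (((natDegree_mul_le_of_le'' (natDegree_mul_le_of_le'' (natDegree_mul_le_of_le'' (natDegree_mul_le_of_le'' (natDegree_ofNat_le' 8) (natDegree_pow_le_of_le 3 ha)) hm) (natDegree_pow_le_of_le 2 hd)) ((natDegree_X_mul_derivative_le _).trans ((natDegree_X_mul_derivative_le _).trans ha)))).trans (by omega))) (((natDegree_mul_le_of_le'' (natDegree_mul_le_of_le'' (natDegree_mul_le_of_le'' (natDegree_mul_le_of_le'' (natDegree_mul_le_of_le'' (natDegree_ofNat_le' 2) (natDegree_pow_le_of_le 3 ha)) hm) hd) ((natDegree_X_mul_derivative_le _).trans ha)) ((natDegree_X_mul_derivative_le _).trans hd))).trans (by omega))) (((natDegree_mul_le_of_le'' (natDegree_mul_le_of_le'' (natDegree_mul_le_of_le''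 (natDegree_pow_le_of_le 3 ha) hm) hd) (natDegree_pow_le_of_le 2 ((natDegree_X_mul_derivative_le _).trans hm)))).trans (by omega))) (((natDegree_mul_le_of_le'' (natDegree_mul_le_of_le'' (natDegree_mul_le_of_le'' (natDegree_mul_le_of_le'' (natDegree_ofNat_le' 4) (natDegree_pow_le_of_le 3 ha)) (natDegree_pow_le_of_le 2 hd)) ((natDegree_X_mul_derivative_le _).trans ha)) ((natDegree_X_mul_derivative_le _).trans hm))).trans (by omega))) (((natDegree_mul_le_of_le'' (natDegree_mul_le_of_le'' (natDegree_pow_le_of_le 2 ha) (natDegree_pow_le_of_le 4 hm)) ((natDegree_X_mul_derivative_le _).trans ((natDegree_X_mul_derivative_le _).trans hm)))).trans (by omega))) (((natDegree_mul_le_of_le'' (natDegree_mul_le_of_le'' (natDegree_mul_le_of_le'' (natDegree_mul_le_of_le'' (natDegree_ofNat_le' 6) (natDegree_pow_le_of_le 2 ha)) (natDegree_pow_le_of_le 3 hm)) hd) ((natDegree_X_mul_derivative_le _).trans ((natDegree_X_mul_derivative_le _).trans ha)))).trans (by omega))) (((natDegree_mul_le_of_le'' (natDegree_mul_le_of_le''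 (natDegree_mul_le_of_le'' (natDegree_mul_le_of_le'' (natDegree_ofNat_le' 2) (natDegree_pow_le_of_le 2 ha)) (natDegree_pow_le_of_le 3 hm)) ((natDegree_X_mul_derivative_le _).trans ha)) ((natDegree_X_mul_derivative_le _).trans hd))).trans (by omega))) (((natDegree_mul_le_of_le'' (natDegree_mul_le_of_le'' (natDegree_pow_le_of_le 2 ha) (natDegree_pow_le_of_le 3 hm)) (natDegree_pow_le_of_le 2 ((natDegree_X_mul_derivative_le _).trans hm)))).trans (by omega))) (((natDegree_mul_le_of_le'' (natDegree_mul_le_of_le'' (natDegree_mul_le_of_le'' (natDegree_mul_le_of_le'' (natDegree_mul_le_of_le'' (natDegree_ofNat_le' 4) (natDegree_pow_le_of_le 2 ha)) (natDegree_pow_le_of_le 2 hm)) hd) ((natDegree_X_mul_derivative_le _).trans ha)) ((natDegree_X_mul_derivative_le _).trans hm))).trans (by omega))) (((natDegree_mul_le_of_le'' (natDegree_mul_le_of_le'' (natDegree_mul_le_of_le'' (natDegree_mul_le_of_le'' (natDegree_ofNat_le' 9) (natDegree_pow_le_of_le 2 ha)) hm) (natDegree_pow_le_of_le 2 hd)) (natDegree_pow_le_of_le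 2 ((natDegree_X_mul_derivative_le _).trans ha)))).trans (by omega))) (((natDegree_mul_le_of_le'' (natDegree_mul_le_of_le'' ha (natDegree_pow_le_of_le 5 hm)) ((natDegree_X_mul_derivative_le _).trans ((natDegree_X_mul_derivative_le _).trans ha)))).trans (by omega))) (((natDegree_mul_le_of_le'' (natDegree_mul_le_of_le'' (natDegree_mul_le_of_le'' (natDegree_mul_le_of_le'' (natDegree_ofNat_le' 7) ha) (natDegree_pow_le_of_le 3 hm)) hd) (natDegree_pow_le_of_le 2 ((natDegree_X_mul_derivative_le _).trans ha)))).trans (by omega))) (((natDegree_mul_le_of_le'' (natDegree_pow_le_of_le 5 hm) (natDegree_pow_le_of_le 2 ((natDegree_X_mul_derivative_le _).trans ha)))).trans (by omega)))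

-- the statement carries `V` (15 products of polynomials).
set_option maxHeartbeats 800000 in
/-- **`deg V ≤ 7α + 6n`** for the weight-13 reduction polynomial `V`. [folklore] -/
theorem natDegree_V_le (a m δ Vp : ℝ[X]) (α n : ℕ) (ha : a.natDegree ≤ α) (hm : m.natDegree ≤ α + n) (hd : δ.natDegree ≤ α + 2 * n)
    (hVp : Vp = (4 : ℝ[X]) * a ^ 4 * δ ^ 2 * (X * derivative (X * derivative δ)) - (4 : ℝ[X]) * a ^ 4 * δ * (X * derivative δ) ^ 2 - a ^ 3 * m ^ 2 * δ * (X * derivative (X * derivative δ)) - (4 : ℝ[X]) * a ^ 3 * m * δ ^ 2 * (X * derivative (X * derivative m)) + (4 : ℝ[X]) * a ^ 3 * m * δ * (X * derivative m) * (X * derivative δ) - (4 : ℝ[X]) * a ^ 3 * δ ^ 3 * (X * derivative (X * derivative a)) + a ^ 2 * m ^ 3 * δ * (X * derivative (X * derivative m)) + (5 : ℝ[X]) * a ^ 2 * m ^ 2 * δ ^ 2 * (X * derivative (X * derivative a)) - (2 : ℝ[X]) * a ^ 2 * m ^ 2 * δ * (X * derivative a) * (X * derivative δ) - a ^ 2 *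 m ^ 2 * δ * (X * derivative m) ^ 2 + (4 : ℝ[X]) * a ^ 2 * m * δ ^ 2 * (X * derivative a) * (X * derivative m) + (4 : ℝ[X]) * a ^ 2 * δ ^ 3 * (X * derivative a) ^ 2 - a * m ^ 4 * δ * (X * derivative (X * derivative a)) - (6 : ℝ[X]) * a * m ^ 2 * δ ^ 2 * (X * derivative a) ^ 2 + m ^ 4 * δ * (X * derivative a) ^ 2) : Vp.natDegree ≤ 7 * α + 6 * n := by
  rw [hVp]
  exact (natDegree_add_le_of_le' (natDegree_sub_le_of_le' (natDegree_sub_le_of_le' (natDegree_add_le_of_le' (natDegree_add_le_of_le' (natDegree_sub_le_of_le' (natDegree_sub_le_of_le' (natDegree_add_le_of_le' (natDegree_add_le_of_le' (natDegree_sub_le_of_le' (natDegree_add_le_of_le' (natDegree_sub_le_of_le' (natDegree_sub_le_of_le' (natDegree_sub_le_of_le' (((natDegree_mul_le_of_le'' (natDegree_mul_le_of_le'' (natDegree_mul_le_of_le'' (natDegree_ofNat_le' 4) (natDegree_pow_le_of_le 4 ha)) (natDegree_pow_le_of_le 2 hd)) ((natDegree_X_mul_derivative_le _).trans ((natDegree_X_mul_derivative_le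 _).trans hd)))).trans (by omega)) (((natDegree_mul_le_of_le'' (natDegree_mul_le_of_le'' (natDegree_mul_le_of_le'' (natDegree_ofNat_le' 4) (natDegree_pow_le_of_le 4 ha)) hd) (natDegree_pow_le_of_le 2 ((natDegree_X_mul_derivative_le _).trans hd)))).trans (by omega))) (((natDegree_mul_le_of_le'' (natDegree_mul_le_of_le'' (natDegree_mul_le_of_le'' (natDegree_pow_le_of_le 3 ha) (natDegree_pow_le_of_le 2 hm)) hd) ((natDegree_X_mul_derivative_le _).trans ((natDegree_X_mul_derivative_le _).trans hd)))).trans (by omega))) (((natDegree_mul_le_of_le'' (natDegree_mul_le_of_le'' (natDegree_mul_le_of_le'' (natDegree_mul_le_of_le'' (natDegree_ofNat_le' 4) (natDegree_pow_le_of_le 3 ha)) hm) (natDegree_pow_le_of_le 2 hd)) ((natDegree_X_mul_derivative_le _).trans ((natDegree_X_mul_derivative_le _).trans hm)))).trans (by omega))) (((natDegree_mul_le_of_le'' (natDegree_mul_le_of_le'' (natDegree_mul_le_of_le'' (natDegree_mul_le_of_le'' (natDegree_mul_le_of_le'' (natDegree_ofNat_le' 4) (natDegree_pow_le_of_le 3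 ha)) hm) hd) ((natDegree_X_mul_derivative_le _).trans hm)) ((natDegree_X_mul_derivative_le _).trans hd))).trans (by omega))) (((natDegree_mul_le_of_le'' (natDegree_mul_le_of_le'' (natDegree_mul_le_of_le'' (natDegree_ofNat_le' 4) (natDegree_pow_le_of_le 3 ha)) (natDegree_pow_le_of_le 3 hd)) ((natDegree_X_mul_derivative_le _).trans ((natDegree_X_mul_derivative_le _).trans ha)))).trans (by omega))) (((natDegree_mul_le_of_le'' (natDegree_mul_le_of_le'' (natDegree_mul_le_of_le'' (natDegree_pow_le_of_le 2 ha) (natDegree_pow_le_of_le 3 hm)) hd) ((natDegree_X_mul_derivative_le _).trans ((natDegree_X_mul_derivative_le _).trans hm)))).trans (by omega))) (((natDegree_mul_le_of_le'' (natDegree_mul_le_of_le'' (natDegree_mul_le_of_le'' (natDegree_mul_le_of_le'' (natDegree_ofNat_le' 5) (natDegree_pow_le_of_le 2 ha)) (natDegree_pow_le_of_le 2 hm)) (natDegree_pow_le_of_le 2 hd)) ((natDegree_X_mul_derivative_le _).trans ((natDegree_X_mul_derivative_le _).trans ha)))).trans (by omega))) (((natDegree_mul_le_of_le'' (natDegree_mul_le_of_le''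 (natDegree_mul_le_of_le'' (natDegree_mul_le_of_le'' (natDegree_mul_le_of_le'' (natDegree_ofNat_le' 2) (natDegree_pow_le_of_le 2 ha)) (natDegree_pow_le_of_le 2 hm)) hd) ((natDegree_X_mul_derivative_le _).trans ha)) ((natDegree_X_mul_derivative_le _).trans hd))).trans (by omega))) (((natDegree_mul_le_of_le'' (natDegree_mul_le_of_le'' (natDegree_mul_le_of_le'' (natDegree_pow_le_of_le 2 ha) (natDegree_pow_le_of_le 2 hm)) hd) (natDegree_pow_le_of_le 2 ((natDegree_X_mul_derivative_le _).trans hm)))).trans (by omega))) (((natDegree_mul_le_of_le'' (natDegree_mul_le_of_le'' (natDegree_mul_le_of_le'' (natDegree_mul_le_of_le'' (natDegree_mul_le_of_le'' (natDegree_ofNat_le' 4) (natDegree_pow_le_of_le 2 ha)) hm) (natDegree_pow_le_of_le 2 hd)) ((natDegree_X_mul_derivative_le _).trans ha)) ((natDegree_X_mul_derivative_le _).trans hm))).trans (by omega))) (((natDegree_mul_le_of_le'' (natDegree_mul_le_of_le'' (natDegree_mul_le_of_le'' (natDegree_ofNat_le' 4) (natDegree_pow_le_of_le 2 ha)) (natDegree_pow_le_of_le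 3 hd)) (natDegree_pow_le_of_le 2 ((natDegree_X_mul_derivative_le _).trans ha)))).trans (by omega))) (((natDegree_mul_le_of_le'' (natDegree_mul_le_of_le'' (natDegree_mul_le_of_le'' ha (natDegree_pow_le_of_le 4 hm)) hd) ((natDegree_X_mul_derivative_le _).trans ((natDegree_X_mul_derivative_le _).trans ha)))).trans (by omega))) (((natDegree_mul_le_of_le'' (natDegree_mul_le_of_le'' (natDegree_mul_le_of_le'' (natDegree_mul_le_of_le'' (natDegree_ofNat_le' 6) ha) (natDegree_pow_le_of_le 2 hm)) (natDegree_pow_le_of_le 2 hd)) (natDegree_pow_le_of_le 2 ((natDegree_X_mul_derivative_le _).trans ha)))).trans (by omega))) (((natDegree_mul_le_of_le'' (natDegree_mul_le_of_le'' (natDegree_pow_le_of_le 4 hm) hd) (natDegree_pow_le_of_le 2 ((natDegree_X_mul_derivative_le _).trans ha)))).trans (by omega)))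

-- the statement carries `U` and `V`.
set_option maxHeartbeats 800000 in
/-- **`deg N ≤ 15α + 12n`** for the eliminant `N = a V² − m U V + δ U²`. [folklore] -/
theorem natDegree_N_le (a m δ Up Vp : ℝ[X]) (α n : ℕ) (ha : a.natDegree ≤ α) (hm : m.natDegree ≤ α + n) (hd : δ.natDegree ≤ α + 2 * n)
    (hUp : Up = (4 : ℝ[X]) * a ^ 4 * m * δ * (X * derivative (X * derivative δ)) - (3 : ℝ[X]) * a ^ 4 * m * (X * derivative δ) ^ 2 + (4 : ℝ[X]) * a ^ 4 * δ ^ 2 * (X * derivative (X * derivative m)) - (4 : ℝ[X]) * a ^ 4 * δ * (X * derivative m) * (X * derivative δ) - a ^ 3 * m ^ 3 * (X * derivative (X * derivative δ)) - (5 : ℝ[X]) * a ^ 3 * m ^ 2 * δ * (X * derivative (X * derivative m)) + (4 : ℝ[X]) * a ^ 3 * m ^ 2 * (X * derivative m) * (X * derivative δ) - (8 : ℝ[X]) * a ^ 3 * m * δ ^ 2 * (X * derivative (X * derivative a)) + (2 : ℝ[X]) * a ^ 3 * m * δ * (X * derivative a) * (X * derivative δ) + a ^ 3 * m * δ * (X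 * derivative m) ^ 2 - (4 : ℝ[X]) * a ^ 3 * δ ^ 2 * (X * derivative a) * (X * derivative m) + a ^ 2 * m ^ 4 * (X * derivative (X * derivative m)) + (6 : ℝ[X]) * a ^ 2 * m ^ 3 * δ * (X * derivative (X * derivative a)) - (2 : ℝ[X]) * a ^ 2 * m ^ 3 * (X * derivative a) * (X * derivative δ) - a ^ 2 * m ^ 3 * (X * derivative m) ^ 2 + (4 : ℝ[X]) * a ^ 2 * m ^ 2 * δ * (X * derivative a) * (X * derivative m) + (9 : ℝ[X]) * a ^ 2 * m * δ ^ 2 * (X * derivative a) ^ 2 - a * m ^ 5 * (X * derivative (X * derivative a)) - (7 : ℝ[X]) * a * m ^ 3 * δ * (X * derivative a) ^ 2 + m ^ 5 * (X * derivative a) ^ 2)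
    (hVp : Vp = (4 : ℝ[X]) * a ^ 4 * δ ^ 2 * (X * derivative (X * derivative δ)) - (4 : ℝ[X]) * a ^ 4 * δ * (X * derivative δ) ^ 2 - a ^ 3 * m ^ 2 * δ * (X * derivative (X * derivative δ)) - (4 : ℝ[X]) * a ^ 3 * m * δ ^ 2 * (X * derivative (X * derivative m)) + (4 : ℝ[X]) * a ^ 3 * m * δ * (X * derivative m) * (X * derivative δ) - (4 : ℝ[X]) * a ^ 3 * δ ^ 3 * (X * derivative (X * derivative a)) + a ^ 2 * m ^ 3 * δ * (X * derivative (X * derivative m)) + (5 : ℝ[X]) * a ^ 2 * m ^ 2 * δ ^ 2 * (X * derivative (X * derivative a)) - (2 : ℝ[X]) * a ^ 2 * m ^ 2 * δ * (X * derivative a) * (X * derivative δ) - a ^ 2 * m ^ 2 * δ * (X * derivative m) ^ 2 + (4 : ℝ[X]) * a ^ 2 * m * δ ^ 2 * (X * derivative a) * (X * derivative m) + (4 : ℝ[X]) * a ^ 2 * δ ^ 3 * (X * derivative a) ^ 2 - a * m ^ 4 * δ * (X * derivative (X * derivative a)) - (6 : ℝ[X]) * a * m ^ 2 * δ ^ 2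 * (X * derivative a) ^ 2 + m ^ 4 * δ * (X * derivative a) ^ 2) :
    (a * Vp ^ 2 - m * Up * Vp + δ * Up ^ 2).natDegree ≤ 15 * α + 12 * n := by
  have hU := natDegree_U_le a m δ Up α n ha hm hd hUp
  have hV := natDegree_V_le a m δ Vp α n ha hm hd hVp
  exact (natDegree_add_le_of_le' (natDegree_sub_le_of_le' (((natDegree_mul_le_of_le'' ha (natDegree_pow_le_of_le 2 hV))).trans (by omega)) (((natDegree_mul_le_of_le'' (natDegree_mul_le_of_le'' hm hU) hV)).trans (by omega))) (((natDegree_mul_le_of_le'' hd (natDegree_pow_le_of_le 2 hU))).trans (by omega)))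

end OsculationCensus

end Summit.ValiantsHypothesis.ValiantsHypothesis.Theorems.LacunarySymmetroidMatrixDescartes
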